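import Summits.BirchSwinnertonDyer.BirchSwinnertonDyer.Theorems.PrintCf2DisegniPairTwoChiLineValuesOdd
import Summits.BirchSwinnertonDyer.BirchSwinnertonDyer.Theorems.PrintCf2DisegniPairTwoChiLinePointwise
import HarnessLib

/-!
# Road (C) `disegni-pair-two` on crux stmt-BirchSwinnertonDyer-20368 — STEP A₂⁻/B₂⁻(1) on the
# `χ₋₄ ∘ N`-line at `p = 2` (`d* = −1`): Disegni's line function at every typed point equals
# `c⁻ ·` (odd-branch MTT value of `f`) `·` (odd-branch MTT value of `f′`) at the SAME point

Cell `bsd-print-cf2`, width seat `bsd-line-cf2-p1-w8` g21; odd twin of `…ChiLineValuesTwo` §3 and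
`…ChiLinePointwise` for the twisting character `ε₋₁ = χ₋₄` (crux class `D ≡ 3 (mod 4)` of
`SplitBadTwoRankOneOfFacts`: `W = E ⊗ χ₋₄`, `E = 49a1^{(d′)}`, `d′ ≡ 1 (4)`). THEOREMS ONLY (no `def`, no
named fact, no `sorry`); `--supports stmt-BirchSwinnertonDyer-20368`. BSD is not proved by any of this.

* §3 STEP A₂⁻: `chiLineValue_chi4_level_two` (`θ = 𝟙`: line character `χ₄∘N`, conductor `4`, `n = 2`;
  value `c⁻·(α⁻²Σχ_{χ₄}[·/4]⁻_f)·(α⁻²Σχ_{χ₄}[·/4]⁻_{f′})` = `c⁻` × the two odd-branch CONSTANT TERMS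
  `L₂⁻(g,α,ω,0) = α⁻²([1/4]⁻−[3/4]⁻)`), `chiLineValue_chi4_of_two_le` (`m ≥ 2`, `θ` primitive even,
  `ξ = θχ₄` primitive odd: value `c⁻·v⁻_f(χ_ξ)·v⁻_{f′}(χ_ξ)` = `c⁻` × the two odd-branch values at the twin
  `χ_θ`, point `T = cycLinePoint ι θ` — `sum_twin_mul_teichWeight_eq_ratMinusTwistedSymbolSum`).
* §4 STEP B₂⁻(1) (Artin formalism `rankinSelbergEulerProductHecke_baseChangeDirichlet_eq_holds` via
  `rankinSelberg_baseChangeDirichlet_eq_mul` + continuations + Theorem A):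
  `hasLineValueAt_chi4Line_zero` (`G(0) = c⁻·v₄(f)·v₄(f′)`) and `hasLineValueAt_chi4Line_of_two_le`
  (`G(pt θ) = c⁻·v⁻_f(χ_{θχ₄})·v⁻_{f′}(χ_{θχ₄})`). No reflection: `G(T) = c⁻·L₂⁻(E,ω,T)·L₂⁻(E′,ω,T)`
  follows in the sibling `…ChiLineFactorisationOdd` by bounded-interpolant uniqueness directly.

`c⁻ = ι⁻¹(−u·Car·Ω⁻_f·Ω⁻_{f′})`, `u = 16/3`. References: [Disegni2017] Thm. A (arXiv v3 PDF pp. 6–7);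
[Gross2004] §3, §13; [MazurTateTeitelbaum1986Invent] §I.8 (8.6), §I.13, §I.14 (14.3); cell PREGRADE §5.
-/

set_option autoImplicit false
set_option linter.dupNamespace false

noncomputable section

open scoped Classical MatrixGroups ModularForm NumberField

open CongruenceSubgroup NumberField IsDedekindDomain Literature.NumberTheory.EllipticCurves
  Literature.NumberTheory.EllipticCurves.ModularForms
  Literature.NumberTheory.EllipticCurves.Disegni2017 Literature.NumberTheory.GaloisRepresentations
  Summit.BirchSwinnertonDyer.Rank1Residual.Additive

namespace Summit.BirchSwinnertonDyer.BirchSwinnertonDyer.Theorems.PrintCf2.DisegniPairTwo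

/-! ### §3 `p = 2`: STEP A₂⁻ — Disegni's interpolation values on the `χ₋₄ ∘ N`-line -/

section StepAOdd

variable (ι : PadicAlgCl 2 ≃+* ℂ) (K : Type) [Field K] [NumberField K] [IsGalois ℚ K]

/-- ★ **STEP A₂⁻ at the base point `θ = 𝟙` of the `χ₋₄∘N`-line** (line character `χ₄∘N`, conductor `4`
at both places, `n = 2`): for entire continuations `Λ₁, Λ₂` of `L(f⊗χ₄, s)`, `L(f′⊗χ₄, s)`,
`chiLineValue(θ = 𝟙) = c⁻ · (α⁻²Σ_b χ_{χ₄}(b)[b/4]⁻_f) · (α⁻²Σ_b χ_{χ₄}(b)[b/4]⁻_{f′})` — the two factors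
being the constant terms `L₂⁻(g, α, ω, 0) = α⁻²([1/4]⁻_g − [3/4]⁻_g)` of the odd branches at `2`
(`constantCoeff_padicLFunctionMinusBranch_one_two`). [cite: Disegni2017, Theorem A (arXiv v3 PDF pp. 6–7)]
[cite: MazurTateTeitelbaum1986Invent, §I.8 (8.6), §I.14 (14.3)] -/
theorem chiLineValue_chi4_level_two (h2 : Module.finrank ℚ K = 2)
    (hsplit : ((Ideal.span {(2 : ℤ)}).primesOver (𝓞 K)).ncard = 2)
    (𝔭 𝔭' : HeightOneSpectrum (𝓞 K)) (h𝔭 : ((2 : ℕ) : 𝓞 K) ∈ 𝔭.asIdeal)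
    (h𝔭' : ((2 : ℕ) : 𝓞 K) ∈ 𝔭'.asIdeal)
    {N N' : ℕ} [NeZero N] [NeZero N'] {f : CuspForm (Gamma0 N) 2} {f' : CuspForm (Gamma0 N') 2}
    (hf : IsNewform0 f) (hQ : coeffField f = ⊥) (hf' : IsNewform0 f') (hQ' : coeffField f' = ⊥)
    (α : ℚ_[2]) (Car : ℝ) (θ : DirichletCharacter ℂ (2 ^ (0 + 1))) {Λ₁ Λ₂ : ℂ → ℂ}
    (hΛ₁ : Differentiable ℂ Λ₁)
    (hΛ₁' : ∀ s : ℂ, 2 < s.re → Λ₁ s =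
      twistedLSeries f (ZMod.χ₄.ringHomComp (Int.castRingHom ℂ) : DirichletCharacter ℂ (2 ^ 2)) s)
    (hΛ₂ : Differentiable ℂ Λ₂)
    (hΛ₂' : ∀ s : ℂ, 2 < s.re → Λ₂ s =
      twistedLSeries f' (ZMod.χ₄.ringHomComp (Int.castRingHom ℂ) : DirichletCharacter ℂ (2 ^ 2)) s) :
    chiLineValue ι K (ι ((α : PadicAlgCl 2))) N
        (baseChangeDirichlet K (ZMod.χ₄.ringHomComp (Int.castRingHom ℂ))) 𝔭 𝔭' θ Car (Λ₁ 1 * Λ₂ 1) =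
      ((ι.symm (-(splitLocalConstant 2 : ℂ) * (Car : ℂ) * (minusPeriod f : ℂ) * (minusPeriod f' : ℂ)) :
          PadicAlgCl 2) : ℂ_[2]) *
        (algebraMap ℚ_[2] ℂ_[2] (α⁻¹ ^ 2) *
          ratMinusTwistedSymbolSum f
            (((ZMod.χ₄.ringHomComp (Int.castRingHom ℂ) : DirichletCharacter ℂ (2 ^ 2))⁻¹.ringHomComp
              ι.symm.toRingHom).ringHomComp (algebraMap (PadicAlgCl 2) ℂ_[2]))) *
        (algebraMap ℚ_[2] ℂ_[2] (α⁻¹ ^ 2) *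
          ratMinusTwistedSymbolSum f'
            (((ZMod.χ₄.ringHomComp (Int.castRingHom ℂ) : DirichletCharacter ℂ (2 ^ 2))⁻¹.ringHomComp
              ι.symm.toRingHom).ringHomComp (algebraMap (PadicAlgCl 2) ℂ_[2]))) := by
  haveI : NeZero (2 ^ 2) := ⟨by norm_num⟩
  rw [chiLineValue, dirichletCharacter_level_two_eq_one θ, baseChangeDirichlet_one, mul_one]
  exact chiLineComplexPart_eq_of_isPrimitive_odd ι K h2 hsplit 𝔭 𝔭' h𝔭 h𝔭' (n := 2) (by norm_num)
    chi4_isPrimitive chi4_odd hf hQ hf' hQ' α Car hΛ₁ hΛ₁' hΛ₂ hΛ₂'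

/-- ★ **STEP A₂⁻ at the points `θ` of level `2^{m+1} ≥ 8` of the `χ₋₄∘N`-line** (`θ` primitive and
even, `m ≥ 2` — this includes `θ = χ₈`, `ξ = χ₋₈`): for entire continuations `Λ₁, Λ₂` of `L(f⊗ξ, s)`,
`L(f′⊗ξ, s)`, `ξ = θχ₄`,
`chiLineValue(θ) = c⁻ · (α^{−(m+1)}Σ_b χ_ξ(b)[b/2^{m+1}]⁻_f) · (α^{−(m+1)}Σ_b χ_ξ(b)[b/2^{m+1}]⁻_{f′})` —
the two factors being the values of the odd branches `L₂⁻(g, α, ω, T)` at the twin `χ_θ`, i.e. at the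
SAME point `T = cycLinePoint ι θ` (`sum_twin_mul_teichWeight_eq_ratMinusTwistedSymbolSum`).
[cite: Disegni2017, Theorem A (arXiv v3 PDF pp. 6–7)] [cite: MazurTateTeitelbaum1986Invent, §I.8 (8.6), §I.14 (14.3)] -/
theorem chiLineValue_chi4_of_two_le (h2 : Module.finrank ℚ K = 2)
    (hsplit : ((Ideal.span {(2 : ℤ)}).primesOver (𝓞 K)).ncard = 2)
    (𝔭 𝔭' : HeightOneSpectrum (𝓞 K)) (h𝔭 : ((2 : ℕ) : 𝓞 K) ∈ 𝔭.asIdeal)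
    (h𝔭' : ((2 : ℕ) : 𝓞 K) ∈ 𝔭'.asIdeal)
    {N N' : ℕ} [NeZero N] [NeZero N'] {f : CuspForm (Gamma0 N) 2} {f' : CuspForm (Gamma0 N') 2}
    (hf : IsNewform0 f) (hQ : coeffField f = ⊥) (hf' : IsNewform0 f') (hQ' : coeffField f' = ⊥)
    (α : ℚ_[2]) (Car : ℝ) {m : ℕ} (hm : 2 ≤ m) (h4 : 4 ∣ 2 ^ (m + 1))
    {θ : DirichletCharacter ℂ (2 ^ (m + 1))} (heven : θ.Even) (hprim : θ.IsPrimitive)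
    {Λ₁ Λ₂ : ℂ → ℂ} (hΛ₁ : Differentiable ℂ Λ₁)
    (hΛ₁' : ∀ s : ℂ, 2 < s.re → Λ₁ s = twistedLSeries f
      (θ * DirichletCharacter.changeLevel h4 (ZMod.χ₄.ringHomComp (Int.castRingHom ℂ))) s)
    (hΛ₂ : Differentiable ℂ Λ₂)
    (hΛ₂' : ∀ s : ℂ, 2 < s.re → Λ₂ s = twistedLSeries f'
      (θ * DirichletCharacter.changeLevel h4 (ZMod.χ₄.ringHomComp (Int.castRingHom ℂ))) s) :
    chiLineValue ι K (ι ((α : PadicAlgCl 2))) N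
        (baseChangeDirichlet K (ZMod.χ₄.ringHomComp (Int.castRingHom ℂ))) 𝔭 𝔭' θ Car (Λ₁ 1 * Λ₂ 1) =
      ((ι.symm (-(splitLocalConstant 2 : ℂ) * (Car : ℂ) * (minusPeriod f : ℂ) * (minusPeriod f' : ℂ)) :
          PadicAlgCl 2) : ℂ_[2]) *
        (algebraMap ℚ_[2] ℂ_[2] (α⁻¹ ^ (m + 1)) *
          ratMinusTwistedSymbolSum f
            (((θ * DirichletCharacter.changeLevel h4 (ZMod.χ₄.ringHomComp (Int.castRingHom ℂ)))⁻¹.ringHomComp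
              ι.symm.toRingHom).ringHomComp (algebraMap (PadicAlgCl 2) ℂ_[2]))) *
        (algebraMap ℚ_[2] ℂ_[2] (α⁻¹ ^ (m + 1)) *
          ratMinusTwistedSymbolSum f'
            (((θ * DirichletCharacter.changeLevel h4 (ZMod.χ₄.ringHomComp (Int.castRingHom ℂ)))⁻¹.ringHomComp
              ι.symm.toRingHom).ringHomComp (algebraMap (PadicAlgCl 2) ℂ_[2]))) := by
  rw [chiLineValue, baseChangeDirichlet_mul_changeLevel K h4 _ θ]
  exact chiLineComplexPart_eq_of_isPrimitive_odd ι K h2 hsplit 𝔭 𝔭' h𝔭 h𝔭' (n := m + 1) (Nat.succ_pos m)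
    (isPrimitive_mul_chi4_changeLevel hm h4 hprim) (odd_mul_chi4_changeLevel h4 heven) hf hQ hf' hQ' α
    Car hΛ₁ hΛ₁' hΛ₂ hΛ₂'

end StepAOdd

/-! ### §4 STEP B₂⁻(1): Disegni's function at the typed points of the `χ₋₄∘N`-line -/

section PointwiseOdd

variable (ι : PadicAlgCl 2 ≃+* ℂ) (K : Type) [Field K] [NumberField K] [IsGalois ℚ K]

/-- ★ **STEP B₂⁻(1) at `T = 0`** (base point `θ = 𝟙` of the `χ₋₄∘N`-line; `K` quadratic, `(2, d_K) = 1`,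
`2` split, `𝔭, 𝔭′ ∋ 2`; `f, f′` rational newforms with `a_n(f′) = κ_K(n)a_n(f)`; `α ∈ ℚ₂`, `a = ι(α)`; `G`
with `ChiLineInterpolation` on the line through `χ₄∘N`): `G(0) = c⁻ · (α⁻²Σ_b χ_{χ₄}(b)[b/4]⁻_f) ·
(α⁻²Σ_b χ_{χ₄}(b)[b/4]⁻_{f′})`. [cite: Disegni2017, Theorem A (arXiv v3 PDF pp. 6–7)] [cite: Gross2004, §3, §13]
[cite: MazurTateTeitelbaum1986Invent, §I.14 (14.3)] -/
theorem hasLineValueAt_chi4Line_zero (h2 : Module.finrank ℚ K = 2)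
    (hsplit : ((Ideal.span {(2 : ℤ)}).primesOver (𝓞 K)).ncard = 2)
    (𝔭 𝔭' : HeightOneSpectrum (𝓞 K)) (h𝔭 : ((2 : ℕ) : 𝓞 K) ∈ 𝔭.asIdeal)
    (h𝔭' : ((2 : ℕ) : 𝓞 K) ∈ 𝔭'.asIdeal)
    (κ : DirichletCharacter ℂ (NumberField.discr K).natAbs)
    (hκ : ∀ ℓ : ℕ, ℓ.Prime → ℓ ≠ 2 → κ ℓ = (jacobiSym (NumberField.discr K) ℓ : ℂ))
    (hκ2 : κ 2 = if NumberField.discr K % 8 = 1 then 1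
        else if NumberField.discr K % 8 = 5 then -1 else 0)
    (hd : Nat.Coprime 2 (NumberField.discr K).natAbs)
    {N N' : ℕ} [NeZero N] [NeZero N'] {f : CuspForm (Gamma0 N) 2} {f' : CuspForm (Gamma0 N') 2}
    (hf : IsNewform0 f) (hQ : coeffField f = ⊥) (hf' : IsNewform0 f') (hQ' : coeffField f' = ⊥)
    (hV' : ∀ n : ℕ, cuspCoeff f' n = κ (n : ZMod _) * cuspCoeff f n)
    (α : ℚ_[2]) {Car : ℝ} {G : PowerSeries ℂ_[2]}
    (hG : ChiLineInterpolation ι K f (ι ((α : PadicAlgCl 2)))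
      (baseChangeDirichlet K (ZMod.χ₄.ringHomComp (Int.castRingHom ℂ))) 𝔭 𝔭' Car G) :
    HasLineValueAt G 0
      (((ι.symm (-(splitLocalConstant 2 : ℂ) * (Car : ℂ) * (minusPeriod f : ℂ) * (minusPeriod f' : ℂ)) :
          PadicAlgCl 2) : ℂ_[2]) *
        (algebraMap ℚ_[2] ℂ_[2] (α⁻¹ ^ 2) *
          ratMinusTwistedSymbolSum f
            (((ZMod.χ₄.ringHomComp (Int.castRingHom ℂ) : DirichletCharacter ℂ (2 ^ 2))⁻¹.ringHomComp
              ι.symm.toRingHom).ringHomComp (algebraMap (PadicAlgCl 2) ℂ_[2]))) *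
        (algebraMap ℚ_[2] ℂ_[2] (α⁻¹ ^ 2) *
          ratMinusTwistedSymbolSum f'
            (((ZMod.χ₄.ringHomComp (Int.castRingHom ℂ) : DirichletCharacter ℂ (2 ^ 2))⁻¹.ringHomComp
              ι.symm.toRingHom).ringHomComp (algebraMap (PadicAlgCl 2) ℂ_[2])))) := by
  haveI : NeZero (2 ^ 2) := ⟨by norm_num⟩
  set χ₄₂ : DirichletCharacter ℂ (2 ^ 2) := ZMod.χ₄.ringHomComp (Int.castRingHom ℂ) with hχ₄₂
  obtain ⟨Λ₁, hΛ₁, hΛ₁'⟩ := exists_differentiable_eq_twistedLSeries_holds (f := f) χ₄₂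
  obtain ⟨Λ₂, hΛ₂, hΛ₂'⟩ := exists_differentiable_eq_twistedLSeries_holds (f := f') χ₄₂
  have hΛ : Differentiable ℂ (fun s ↦ Λ₁ s * Λ₂ s) := hΛ₁.mul hΛ₂
  have hRS : ∀ s : ℂ, 2 < s.re → (fun s ↦ Λ₁ s * Λ₂ s) s =
      rankinSelbergEulerProductHecke f
        (baseChangeDirichlet K (ZMod.χ₄.ringHomComp (Int.castRingHom ℂ)) *
          baseChangeDirichlet K (1 : DirichletCharacter ℂ (2 ^ (0 + 1)))) s := by
    intro s hs
    rw [baseChangeDirichlet_one, mul_one]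
    exact rankinSelberg_baseChangeDirichlet_eq_mul K h2 κ hκ hκ2 hd hf hV' chi4_isPrimitive hΛ₁' hΛ₂' s hs
  have hval := hG.hasLineValueAt (θ := (1 : DirichletCharacter ℂ (2 ^ (0 + 1))))
    (MulChar.one_apply isUnit_one.neg) ⟨0, by rw [orderOf_one, pow_zero]⟩ (Or.inr rfl) hΛ hRS
  rw [cycLinePoint_one] at hval
  rwa [chiLineValue_chi4_level_two ι K h2 hsplit 𝔭 𝔭' h𝔭 h𝔭' hf hQ hf' hQ' α Car 1 hΛ₁ hΛ₁' hΛ₂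
    hΛ₂'] at hval

/-- ★ **STEP B₂⁻(1) at the points of level `2^{m+1} ≥ 8`** (`θ` primitive and even mod `2^{m+1}`,
`m ≥ 2`, `ξ = θχ₄`): `G(cycLinePoint ι θ) = c⁻ · (α^{−(m+1)}Σ_b χ_ξ(b)[b/2^{m+1}]⁻_f) ·
(α^{−(m+1)}Σ_b χ_ξ(b)[b/2^{m+1}]⁻_{f′})` — the two factors being the odd-branch MTT values at the twin
`χ_θ`, SAME point. [cite: Disegni2017, Theorem A (arXiv v3 PDF pp. 6–7)] [cite: Gross2004, §3, §13]
[cite: MazurTateTeitelbaum1986Invent, §I.8 (8.6), §I.14 (14.3)] -/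
theorem hasLineValueAt_chi4Line_of_two_le (h2 : Module.finrank ℚ K = 2)
    (hsplit : ((Ideal.span {(2 : ℤ)}).primesOver (𝓞 K)).ncard = 2)
    (𝔭 𝔭' : HeightOneSpectrum (𝓞 K)) (h𝔭 : ((2 : ℕ) : 𝓞 K) ∈ 𝔭.asIdeal)
    (h𝔭' : ((2 : ℕ) : 𝓞 K) ∈ 𝔭'.asIdeal)
    (κ : DirichletCharacter ℂ (NumberField.discr K).natAbs)
    (hκ : ∀ ℓ : ℕ, ℓ.Prime → ℓ ≠ 2 → κ ℓ = (jacobiSym (NumberField.discr K) ℓ : ℂ))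
    (hκ2 : κ 2 = if NumberField.discr K % 8 = 1 then 1
        else if NumberField.discr K % 8 = 5 then -1 else 0)
    (hd : Nat.Coprime 2 (NumberField.discr K).natAbs)
    {N N' : ℕ} [NeZero N] [NeZero N'] {f : CuspForm (Gamma0 N) 2} {f' : CuspForm (Gamma0 N') 2}
    (hf : IsNewform0 f) (hQ : coeffField f = ⊥) (hf' : IsNewform0 f') (hQ' : coeffField f' = ⊥)
    (hV' : ∀ n : ℕ, cuspCoeff f' n = κ (n : ZMod _) * cuspCoeff f n)
    (α : ℚ_[2]) {Car : ℝ} {G : PowerSeries ℂ_[2]}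
    (hG : ChiLineInterpolation ι K f (ι ((α : PadicAlgCl 2)))
      (baseChangeDirichlet K (ZMod.χ₄.ringHomComp (Int.castRingHom ℂ))) 𝔭 𝔭' Car G)
    {m : ℕ} (hm : 2 ≤ m) (h4 : 4 ∣ 2 ^ (m + 1)) {θ : DirichletCharacter ℂ (2 ^ (m + 1))}
    (heven : θ.Even) (hprim : θ.IsPrimitive) :
    HasLineValueAt G (cycLinePoint ι θ)
      (((ι.symm (-(splitLocalConstant 2 : ℂ) * (Car : ℂ) * (minusPeriod f : ℂ) * (minusPeriod f' : ℂ)) :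
          PadicAlgCl 2) : ℂ_[2]) *
        (algebraMap ℚ_[2] ℂ_[2] (α⁻¹ ^ (m + 1)) *
          ratMinusTwistedSymbolSum f
            (((θ * DirichletCharacter.changeLevel h4 (ZMod.χ₄.ringHomComp (Int.castRingHom ℂ)))⁻¹.ringHomComp
              ι.symm.toRingHom).ringHomComp (algebraMap (PadicAlgCl 2) ℂ_[2]))) *
        (algebraMap ℚ_[2] ℂ_[2] (α⁻¹ ^ (m + 1)) *
          ratMinusTwistedSymbolSum f'
            (((θ * DirichletCharacter.changeLevel h4 (ZMod.χ₄.ringHomComp (Int.castRingHom ℂ)))⁻¹.ringHomComp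
              ι.symm.toRingHom).ringHomComp (algebraMap (PadicAlgCl 2) ℂ_[2])))) := by
  set ξ := θ * DirichletCharacter.changeLevel h4 (ZMod.χ₄.ringHomComp (Int.castRingHom ℂ)) with hξ
  have hξprim : ξ.IsPrimitive := isPrimitive_mul_chi4_changeLevel hm h4 hprim
  obtain ⟨Λ₁, hΛ₁, hΛ₁'⟩ := exists_differentiable_eq_twistedLSeries_holds (f := f) ξ
  obtain ⟨Λ₂, hΛ₂, hΛ₂'⟩ := exists_differentiable_eq_twistedLSeries_holds (f := f') ξ
  have hΛ : Differentiable ℂ (fun s ↦ Λ₁ s * Λ₂ s) := hΛ₁.mul hΛ₂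
  have hRS : ∀ s : ℂ, 2 < s.re → (fun s ↦ Λ₁ s * Λ₂ s) s =
      rankinSelbergEulerProductHecke f
        (baseChangeDirichlet K (ZMod.χ₄.ringHomComp (Int.castRingHom ℂ)) * baseChangeDirichlet K θ) s := by
    intro s hs
    rw [baseChangeDirichlet_mul_changeLevel K h4 _ θ]
    exact rankinSelberg_baseChangeDirichlet_eq_mul K h2 κ hκ hκ2 hd hf hV' hξprim hΛ₁' hΛ₂' s hs
  have hval := hG.hasLineValueAt (θ := θ) heven (exists_orderOf_eq_two_pow θ) (Or.inl hprim) hΛ hRS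
  rwa [chiLineValue_chi4_of_two_le ι K h2 hsplit 𝔭 𝔭' h𝔭 h𝔭' hf hQ hf' hQ' α Car hm h4 heven hprim
    hΛ₁ hΛ₁' hΛ₂ hΛ₂'] at hval

end PointwiseOdd

end Summit.BirchSwinnertonDyer.BirchSwinnertonDyer.Theorems.PrintCf2.DisegniPairTwo

end
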